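import Summits.ValiantsHypothesis.ValiantsHypothesis.Theorems.SymPencilEquivariantSdcNotQPPermEmbeddingOfIrreducible
import HarnessLib

/-!
# ValiantsHypothesis / SymPencil — crux `SymmetrizePermPairs` (stmt-ValiantsHypothesis-17793),
# stub `stub_induce`, ASSEMBLY [A2]: Maschke glue (D)_H → (iii″)_H for a lift group over a
# SUBGROUP of `𝔖_n × 𝔖_n`

Subgroup form of the closed sister crux's `permEmbedding_of_irreducible` ((iii″) ⇐ (D),
`…PermEmbeddingOfIrreducible.lean`): the finite group `G` maps to `𝔖_n × 𝔖_n` by `φ` without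
surjectivity and the quasi-polynomial budgets carry the extra summand `log₂ [𝔖_n × 𝔖_n : φ(G)]`:

  (D)_H   : every IRREDUCIBLE `ρ : G → GL_k(ℂ)`, scalar with `M`-th roots of unity on `ker φ`, `k ≤ M`,
            is an equivariant retract of a permutation representation of size
            `≤ 2^{(log₂ M + log₂ n + log₂ R + d)^d}` (`R = [𝔖_n² : φ(G)]`);
  (iii″)_H: every `ρ : G → GL_{m₀}(ℂ)`, unimodular and scalar on `ker φ`, is an equivariant retract of
            a permutation representation of size `≤ 2^{(log₂ m₀ + log₂ n + log₂ R + d)^d}`.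

`permEmbedding_sub_of_irreducible : (D)_H → (iii″)_H` — the same Maschke induction, `φ` only passed
along.  (D)_H itself is `permEmbeddingD_sub_of_bounds` ([A1], from (GS), (H1)₂, (H2)₂).

Honest framing: assembly layer for an OPEN stub of an OPEN crux; the symmetric-output core (C3) is
untouched; `VP ≠ VNP` is NOT proved and nothing here is progress on it.  No new definitions, no named
facts (`--supports stmt-ValiantsHypothesis-17793 --as helper`).
-/

noncomputable section

-- `Summit.ValiantsHypothesis.ValiantsHypothesis.…` is the tree's mandated single-conjunct layout
-- (Sub = Summit), so the duplicated namespace component is intended.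
set_option linter.dupNamespace false

namespace Summit.ValiantsHypothesis.ValiantsHypothesis.Theorems.SymPencilEquivariantSdcNotQP

open Module Submodule

/-- **(iii″)_H from the irreducible case (D)_H** — subgroup form of `permEmbedding_of_irreducible`:
the finite group `G` maps to `𝔖_n × 𝔖_n` by `φ` WITHOUT surjectivity, and both budgets carry the
extra summand `log₂ [𝔖_n × 𝔖_n : φ(G)]`.  Same Maschke induction (`exists_invariant_compl`,
`linRetract_sum`, `linRetract_reindex`, `linRetract_of_equiv`, `mul_budget_le`); `φ` is only passed
along. [folklore] -/
theorem permEmbedding_sub_of_irreducible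
    (hD : ∃ d : ℕ, ∀ (n M k : ℕ) (G : Type) [Group G] [Finite G]
      (φ : G →* Equiv.Perm (Fin n) × Equiv.Perm (Fin n)) (ρ : G →* GL (Fin k) ℂ),
      (∀ g : G, φ g = 1 → ∃ c : ℂ, c ^ M = 1 ∧
        (ρ g : Matrix (Fin k) (Fin k) ℂ) = c • (1 : Matrix (Fin k) (Fin k) ℂ)) →
      k ≤ M →
      (∀ W : Submodule ℂ (Fin k → ℂ),
        (∀ g : G, W ≤ W.comap (Matrix.toLin' (ρ g : Matrix (Fin k) (Fin k) ℂ))) → W = ⊥ ∨ W = ⊤) →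
      ∃ m' ≤ 2 ^ ((Nat.log 2 M + Nat.log 2 n + Nat.log 2 φ.range.index + d) ^ d),
        ∃ (ι : Matrix (Fin m') (Fin k) ℂ) (p : Matrix (Fin k) (Fin m') ℂ) (τ : G → Equiv.Perm (Fin m')),
          p * ι = 1 ∧ ∀ g : G,
            (τ g).permMatrix ℂ * ι = ι * (ρ g : Matrix (Fin k) (Fin k) ℂ) ∧
            p * (τ g).permMatrix ℂ = (ρ g : Matrix (Fin k) (Fin k) ℂ) * p) :
    ∃ d : ℕ, ∀ (n m₀ : ℕ) (G : Type) [Group G] [Finite G]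
      (φ : G →* Equiv.Perm (Fin n) × Equiv.Perm (Fin n)) (ρ : G →* GL (Fin m₀) ℂ),
      (∀ g : G, φ g = 1 → ∃ c : ℂ, (ρ g : Matrix (Fin m₀) (Fin m₀) ℂ) = c • (1 : Matrix (Fin m₀) (Fin m₀) ℂ)) →
      (∀ g : G, Matrix.det (ρ g : Matrix (Fin m₀) (Fin m₀) ℂ) = 1) →
      ∃ m' ≤ 2 ^ ((Nat.log 2 m₀ + Nat.log 2 n + Nat.log 2 φ.range.index + d) ^ d),
        ∃ (ι : Matrix (Fin m') (Fin m₀) ℂ) (p : Matrix (Fin m₀) (Fin m') ℂ) (τ : G → Equiv.Perm (Fin m')),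
          p * ι = 1 ∧ ∀ g : G,
            (τ g).permMatrix ℂ * ι = ι * (ρ g : Matrix (Fin m₀) (Fin m₀) ℂ) ∧
            p * (τ g).permMatrix ℂ = (ρ g : Matrix (Fin m₀) (Fin m₀) ℂ) * p := by
  classical
  obtain ⟨d, hd⟩ := hD
  refine ⟨d + 2, fun n m₀ G _ _ φ ρ hker hdet => ?_⟩
  set Bd : ℕ := 2 ^ ((Nat.log 2 m₀ + Nat.log 2 n + Nat.log 2 φ.range.index + d) ^ d) with hBd
  -- on the kernel: scalars with `c ^ m₀ = 1`
  have hkerM : ∀ g : G, φ g = 1 → ∃ c : ℂ, c ^ m₀ = 1 ∧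
      (ρ g : Matrix (Fin m₀) (Fin m₀) ℂ) = c • (1 : Matrix (Fin m₀) (Fin m₀) ℂ) := by
    intro g hg
    obtain ⟨c, hc⟩ := hker g hg
    refine ⟨c, ?_, hc⟩
    have := hdet g
    rwa [hc, Matrix.det_smul, Matrix.det_one, mul_one, Fintype.card_fin] at this
  -- Maschke induction on the dimension, at the linear level
  have key : ∀ (r : ℕ) (V : Type) [AddCommGroup V] [Module ℂ V] [FiniteDimensional ℂ V]
      (T : G →* (V →ₗ[ℂ] V)), Module.finrank ℂ V ≤ r → Module.finrank ℂ V ≤ m₀ →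
      (∀ g : G, φ g = 1 → ∃ c : ℂ, c ^ m₀ = 1 ∧ T g = c • LinearMap.id) →
      ∃ (m' : ℕ) (ι : V →ₗ[ℂ] (Fin m' → ℂ)) (p : (Fin m' → ℂ) →ₗ[ℂ] V)
        (τ : G → Equiv.Perm (Fin m')),
        m' ≤ Module.finrank ℂ V * Bd ∧ p ∘ₗ ι = LinearMap.id ∧
        ∀ g, LinearMap.funLeft ℂ ℂ (τ g) ∘ₗ ι = ι ∘ₗ T g ∧
          p ∘ₗ LinearMap.funLeft ℂ ℂ (τ g) = T g ∘ₗ p := by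
    intro r
    induction r with
    | zero =>
      intro V _ _ _ T hr _ _
      haveI : Subsingleton V := Module.finrank_zero_iff.mp (Nat.le_zero.mp hr)
      refine ⟨0, 0, 0, fun _ => 1, le_rfl.trans (Nat.zero_le _), ?_, fun g => ⟨?_, ?_⟩⟩
      · exact LinearMap.ext fun v => Subsingleton.elim _ _
      · rw [LinearMap.comp_zero, LinearMap.zero_comp]
      · rw [LinearMap.zero_comp, LinearMap.comp_zero]
    | succ r ih =>
      intro V _ _ _ T hr hM hsc
      by_cases hle : Module.finrank ℂ V ≤ r
      · exact ih V T hle hM hsc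
      have hrk : Module.finrank ℂ V = r + 1 := by omega
      by_cases hirr : ∀ W : Submodule ℂ V, (∀ g, W ≤ W.comap (T g)) → W = ⊥ ∨ W = ⊤
      · -- irreducible: pass to matrices in a basis and use (D)
        set k : ℕ := Module.finrank ℂ V with hk
        let b : Module.Basis (Fin k) ℂ V := Module.finBasis ℂ V
        let ρV : G →* GL (Fin k) ℂ :=
          (Units.map ((LinearMap.toMatrixAlgEquiv b :
            (V →ₗ[ℂ] V) ≃ₐ[ℂ] Matrix (Fin k) (Fin k) ℂ).toMonoidHom)).comp T.toHomUnits
        have hρV : ∀ g, (ρV g : Matrix (Fin k) (Fin k) ℂ) = LinearMap.toMatrix b b (T g) := fun g => rfl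
        -- `b.equivFun ∘ T g = ρV g ∘ b.equivFun`
        have hconj : ∀ g, (b.equivFun : V ≃ₗ[ℂ] (Fin k → ℂ)).toLinearMap ∘ₗ T g =
            Matrix.toLin' (ρV g : Matrix (Fin k) (Fin k) ℂ) ∘ₗ
              (b.equivFun : V ≃ₗ[ℂ] (Fin k → ℂ)).toLinearMap := by
          intro g
          refine LinearMap.ext fun v => ?_
          simp only [LinearMap.coe_comp, LinearEquiv.coe_coe, Function.comp_apply, hρV,
            Matrix.toLin'_apply, Module.Basis.equivFun_apply, LinearMap.toMatrix_mulVec_repr]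
        have hconj' : ∀ g, (b.equivFun.symm : (Fin k → ℂ) ≃ₗ[ℂ] V).toLinearMap ∘ₗ
            Matrix.toLin' (ρV g : Matrix (Fin k) (Fin k) ℂ) =
              T g ∘ₗ (b.equivFun.symm : (Fin k → ℂ) ≃ₗ[ℂ] V).toLinearMap := by
          intro g
          refine LinearMap.ext fun w => ?_
          have := LinearMap.congr_fun (hconj g) (b.equivFun.symm w)
          simp only [LinearMap.coe_comp, LinearEquiv.coe_coe, Function.comp_apply,
            LinearEquiv.apply_symm_apply] at this
          simp only [LinearMap.coe_comp, LinearEquiv.coe_coe, Function.comp_apply]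
          rw [← this, LinearEquiv.symm_apply_apply]
        -- irreducibility in coordinates
        have hirr' : ∀ W : Submodule ℂ (Fin k → ℂ),
            (∀ g : G, W ≤ W.comap (Matrix.toLin' (ρV g : Matrix (Fin k) (Fin k) ℂ))) →
              W = ⊥ ∨ W = ⊤ := by
          intro W hW
          have hWc : ∀ g, W.comap (b.equivFun : V ≃ₗ[ℂ] (Fin k → ℂ)).toLinearMap ≤
              (W.comap (b.equivFun : V ≃ₗ[ℂ] (Fin k → ℂ)).toLinearMap).comap (T g) := by
            intro g v hv
            rw [Submodule.mem_comap] at hv ⊢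
            rw [Submodule.mem_comap]
            have h2 := LinearMap.congr_fun (hconj g) v
            simp only [LinearMap.coe_comp, LinearEquiv.coe_coe, Function.comp_apply] at h2
            rw [LinearEquiv.coe_coe, h2]
            exact hW g hv
          have hmap : (W.comap (b.equivFun : V ≃ₗ[ℂ] (Fin k → ℂ)).toLinearMap).map
              (b.equivFun : V ≃ₗ[ℂ] (Fin k → ℂ)).toLinearMap = W :=
            Submodule.map_comap_eq_of_surjective b.equivFun.surjective W
          rcases hirr _ hWc with h | h
          · left; rw [← hmap, h, Submodule.map_bot]
          · right; rw [← hmap, h, Submodule.map_top, LinearEquiv.range]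
        have hkerV : ∀ g, φ g = 1 → ∃ c : ℂ, c ^ m₀ = 1 ∧
            (ρV g : Matrix (Fin k) (Fin k) ℂ) = c • (1 : Matrix (Fin k) (Fin k) ℂ) := by
          intro g hg
          obtain ⟨c, hc, hTg⟩ := hsc g hg
          refine ⟨c, hc, ?_⟩
          rw [hρV, hTg, map_smul, LinearMap.toMatrix_id]
        obtain ⟨m', hm', ιM, pM, τ, hpι, hrel⟩ := hd n m₀ k G φ ρV hkerV (hk ▸ hM) hirr'
        -- matrix retract → linear retract on coordinates
        have hpιL : Matrix.toLin' pM ∘ₗ Matrix.toLin' ιM = LinearMap.id := by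
          rw [← Matrix.toLin'_mul, hpι, Matrix.toLin'_one]
        have hrelL : ∀ g, LinearMap.funLeft ℂ ℂ (τ g) ∘ₗ Matrix.toLin' ιM =
            Matrix.toLin' ιM ∘ₗ Matrix.toLin' (ρV g : Matrix (Fin k) (Fin k) ℂ) ∧
            Matrix.toLin' pM ∘ₗ LinearMap.funLeft ℂ ℂ (τ g) =
              Matrix.toLin' (ρV g : Matrix (Fin k) (Fin k) ℂ) ∘ₗ Matrix.toLin' pM := by
          intro g
          rw [← toLin'_permMatrix, ← Matrix.toLin'_mul, ← Matrix.toLin'_mul, ← Matrix.toLin'_mul,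
            ← Matrix.toLin'_mul, (hrel g).1, (hrel g).2]
          exact ⟨rfl, rfl⟩
        -- transport to `V`
        obtain ⟨h1, h2⟩ := linRetract_of_equiv (fun g => Matrix.toLin' (ρV g : Matrix (Fin k) (Fin k) ℂ))
          (fun g => T g) b.equivFun.symm hconj' (Matrix.toLin' ιM) (Matrix.toLin' pM) τ hpιL hrelL
        refine ⟨m', _, _, τ, ?_, h1, h2⟩
        have hk1 : 1 ≤ k := by omega
        calc m' ≤ Bd := hm'
          _ = 1 * Bd := (one_mul _).symm
          _ ≤ k * Bd := Nat.mul_le_mul_right _ hk1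
      · -- reducible: split along a Maschke complement
        push Not at hirr
        obtain ⟨W, hWinv, hWbot, hWtop⟩ := hirr
        obtain ⟨W', hcW, hW'inv⟩ := exists_invariant_compl T hWinv
        -- the restricted homomorphisms
        let TW : G →* (W →ₗ[ℂ] W) :=
          { toFun := fun g => (T g).restrict (hWinv g)
            map_one' := by
              refine LinearMap.ext fun w => Subtype.ext ?_
              simp [LinearMap.coe_restrict_apply]
            map_mul' := fun a c => by
              refine LinearMap.ext fun w => Subtype.ext ?_
              simp [LinearMap.coe_restrict_apply, Module.End.mul_apply] }
        let TW' : G →* (W' →ₗ[ℂ] W') :=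
          { toFun := fun g => (T g).restrict (hW'inv g)
            map_one' := by
              refine LinearMap.ext fun w => Subtype.ext ?_
              simp [LinearMap.coe_restrict_apply]
            map_mul' := fun a c => by
              refine LinearMap.ext fun w => Subtype.ext ?_
              simp [LinearMap.coe_restrict_apply, Module.End.mul_apply] }
        have hTW : ∀ g, TW g = (T g).restrict (hWinv g) := fun g => rfl
        have hTW' : ∀ g, TW' g = (T g).restrict (hW'inv g) := fun g => rfl
        -- dimensions
        have hsum : Module.finrank ℂ W + Module.finrank ℂ W' = Module.finrank ℂ V := by
          have := Submodule.finrank_sup_add_finrank_inf_eq W W'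
          rw [hcW.sup_eq_top, hcW.inf_eq_bot, finrank_top, finrank_bot, add_zero] at this
          exact this.symm
        have hdW : Module.finrank ℂ W < Module.finrank ℂ V :=
          Submodule.finrank_lt hWtop
        have hW'top : W' ≠ ⊤ := by
          intro h
          apply hWbot
          have := hcW.inf_eq_bot
          rwa [h, inf_top_eq] at this
        have hdW' : Module.finrank ℂ W' < Module.finrank ℂ V :=
          Submodule.finrank_lt hW'top
        -- scalars on the kernel restrict
        have hscW : ∀ g, φ g = 1 → ∃ c : ℂ, c ^ m₀ = 1 ∧ TW g = c • LinearMap.id := by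
          intro g hg
          obtain ⟨c, hc, hTg⟩ := hsc g hg
          refine ⟨c, hc, LinearMap.ext fun w => Subtype.ext ?_⟩
          simp [hTW, LinearMap.coe_restrict_apply, hTg]
        have hscW' : ∀ g, φ g = 1 → ∃ c : ℂ, c ^ m₀ = 1 ∧ TW' g = c • LinearMap.id := by
          intro g hg
          obtain ⟨c, hc, hTg⟩ := hsc g hg
          refine ⟨c, hc, LinearMap.ext fun w => Subtype.ext ?_⟩
          simp [hTW', LinearMap.coe_restrict_apply, hTg]
        obtain ⟨a, ι₁, p₁, τ₁, ha, hpι₁, hr₁⟩ := ih W TW (by omega) (by omega) hscW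
        obtain ⟨a', ι₂, p₂, τ₂, ha', hpι₂, hr₂⟩ := ih W' TW' (by omega) (by omega) hscW'
        obtain ⟨ι, p, τ, hpι, hr⟩ := linRetract_sum (fun g => T g) hcW hWinv hW'inv
          ι₁ p₁ τ₁ hpι₁ (fun g => hr₁ g) ι₂ p₂ τ₂ hpι₂ (fun g => hr₂ g)
        obtain ⟨ι', p', τ', hpι', hr'⟩ := linRetract_reindex finSumFinEquiv (fun g => T g) ι p τ hpι hr
        refine ⟨a + a', ι', p', τ', ?_, hpι', hr'⟩
        calc a + a' ≤ Module.finrank ℂ W * Bd + Module.finrank ℂ W' * Bd := add_le_add ha ha'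
          _ = Module.finrank ℂ V * Bd := by rw [← add_mul, hsum]
  -- apply to `ℂ^{m₀}` with `T g = ρ g`
  let T : G →* ((Fin m₀ → ℂ) →ₗ[ℂ] (Fin m₀ → ℂ)) :=
    { toFun := fun g => Matrix.toLin' (ρ g : Matrix (Fin m₀) (Fin m₀) ℂ)
      map_one' := by simp only [map_one, Units.val_one, Matrix.toLin'_one]; rfl
      map_mul' := fun a c => by
        simp only [map_mul, Units.val_mul, Matrix.toLin'_mul]; rfl }
  have hT : ∀ g, T g = Matrix.toLin' (ρ g : Matrix (Fin m₀) (Fin m₀) ℂ) := fun g => rfl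
  have hscT : ∀ g, φ g = 1 → ∃ c : ℂ, c ^ m₀ = 1 ∧ T g = c • LinearMap.id := by
    intro g hg
    obtain ⟨c, hc, hρg⟩ := hkerM g hg
    refine ⟨c, hc, ?_⟩
    rw [hT, hρg, map_smul, Matrix.toLin'_one]
  obtain ⟨m', ι, p, τ, hm', hpι, hr⟩ :=
    key m₀ (Fin m₀ → ℂ) T (by rw [Module.finrank_fin_fun]) (by rw [Module.finrank_fin_fun]) hscT
  rw [Module.finrank_fin_fun] at hm'
  have hbud : m₀ * Bd ≤
      2 ^ ((Nat.log 2 m₀ + Nat.log 2 n + Nat.log 2 φ.range.index + (d + 2)) ^ (d + 2)) := by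
    rw [hBd]
    have h := mul_budget_le m₀ (Nat.log 2 m₀) (Nat.log 2 n + Nat.log 2 φ.range.index) d
      (Nat.lt_pow_succ_log_self one_lt_two m₀)
    simpa only [Nat.add_assoc] using h
  refine ⟨m', hm'.trans hbud, LinearMap.toMatrix' ι, LinearMap.toMatrix' p, τ, ?_,
    fun g => ⟨?_, ?_⟩⟩
  · rw [← LinearMap.toMatrix'_comp, hpι, LinearMap.toMatrix'_id]
  · have hperm : (τ g).permMatrix ℂ = LinearMap.toMatrix' (LinearMap.funLeft ℂ ℂ (τ g)) := by
      rw [← toLin'_permMatrix, LinearMap.toMatrix'_toLin']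
    rw [hperm, ← LinearMap.toMatrix'_comp, (hr g).1, LinearMap.toMatrix'_comp, hT,
      LinearMap.toMatrix'_toLin']
  · have hperm : (τ g).permMatrix ℂ = LinearMap.toMatrix' (LinearMap.funLeft ℂ ℂ (τ g)) := by
      rw [← toLin'_permMatrix, LinearMap.toMatrix'_toLin']
    rw [hperm, ← LinearMap.toMatrix'_comp, (hr g).2, LinearMap.toMatrix'_comp, hT,
      LinearMap.toMatrix'_toLin']

end Summit.ValiantsHypothesis.ValiantsHypothesis.Theorems.SymPencilEquivariantSdcNotQP

end
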